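import Summits.QuantumAdvantage.QuantumAdvantage.Theorems.LinnikCubicClassGroupsDegreeOnePrimesEscapeThetaDecay
import Literature.NumberTheory.LFunctions.MertensNumberFieldConstant
import Literature.NumberTheory.LFunctions.MoebiusHarmonicSumBound
import HarnessLib

/-!
# Mertens' second theorem for number fields, UNIFORMLY in the Linnik range:
# `∑_{N𝔭 ≤ x} 1/N𝔭 = log log x + M_K + O_n((log Q / log x)²)` for every `K` without quadratic subfield

Topic `Summits/QuantumAdvantage/QuantumAdvantage/Theorems`, cell B2b-1 (linnik-cubic), PART A (maintenance
seat, generation 15); helper for the crux `DegreeOnePrimesEscape` (stmt-QuantumAdvantage-11543) of route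
`LinnikCubicClassGroups`.  HONEST FRAMING: the value of this file is a THEOREM (kernel-checked, GRH-free,
Siegel-free) — NOT summit progress (the route rests on the hypothesis-type target `PureCubicClassNumberHard`).

Mertens' theorems for the prime ideals of a FIXED number field are classical (Landau 1903, Rosen 1999; tree:
`Literature/NumberTheory/LFunctions/MertensPrimeIdeals.lean`, `O_K(1)` forms); their known UNIFORM versions
(Lebacque 2007, Garcia–Lee 2021) have error terms of size `|d_K|^{1/(n+1)}/log x` or need
`log x ≫ (log|d_K|)²`, i.e. ranges exponential in the discriminant.  From the prime ideal theorem with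
exponentially decaying error IN THE LINNIK RANGE (`abs_chebyshevThetaIdeal_sub_self_le_of_noQuadraticSubfield`,
previous file: log-free zero density + Stark, no Siegel zero for fields without quadratic subfield) we get,
by partial summation, a uniform Mertens theorem whose error is already `< ε` at `x = Q^{C(n,ε)}`,
`Q = |d_K|·nⁿ` — a polynomial range:

* (Literature, `MertensNumberFieldConstant.lean`) `ThetaMertens.abs_sum_div_mul_log_sub_loglog_le_explicit` —
  partial summation with the constant kept: `|∑_{n ≤ t} c(n) − t| ≤ C t/log² t` gives
  `|∑_{n ≤ x} c(n)/(n log n) − (log log x + m)| ≤ 4C/log² x`; and `NumberField.exists_mertensConstant`,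
  `NumberField.tendsto_sum_inv_absNorm_sub_loglog` (Mertens' constant `M_K` of every number field, Rosen 1999);
* `abs_chebyshevThetaIdeal_sub_self_le_logSq_uniform` — for `K` of degree `n` without quadratic subfield,
  `|θ_K(t) − t| ≤ Γ(n)·(log Q)²·t/log² t` for ALL `t ≥ 2` (the decaying error `e^{−c log t/log Q} +
  e^{−√(c log t)} + t^{−ν}` is `≤ Γ₁ (log Q)²/log² t`; below `Q^{a₁}` Chebyshev's bound suffices);
* `mertens_second_uniform` — **for `n > 1` there is `Γ = Γ(n)` such that every number field `K` of degree `n`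
  without quadratic subfield has a constant `M_K` with
  `|∑_{N𝔭 ≤ x} 1/N𝔭 − log log x − M_K| ≤ Γ·(log Q)²/(log x)²` for all `x ≥ 2`**; in particular
  (`mertens_second_uniform_eps`) for every `ε > 0` there is `C = C(n, ε)` with
  `|∑_{N𝔭 ≤ x} 1/N𝔭 − log log x − M_K| ≤ ε` for every such `K` and every `x ≥ Q^C`.
  Odd degree and cubic fields: `mertens_second_uniform_of_odd`, `mertens_second_uniform_cubic`.

`M_K` is Mertens' constant of `K` (`= γ + log κ_K + ∑_𝔭 [log(1 − 1/N𝔭) + 1/N𝔭]`, Rosen 1999 Thm 2; the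
identification is the sequel's business); here it is produced as the limit of `∑_{N𝔭 ≤ x} 1/N𝔭 − log log x`.

## References

* M. Rosen, *A generalization of Mertens' theorem*, J. Ramanujan Math. Soc. 14 (1999) 1–19. [Rosen1999Mertens]
* P. Lebacque, *Generalised Mertens and Brauer–Siegel theorems*, Acta Arith. 130 (2007) 333–350.
* S. R. Garcia, E. S. Lee, *Unconditional explicit Mertens' theorems for number fields and Dedekind zeta
  residue bounds*, Ramanujan J. (2021), Thm 1 (arXiv:2007.10313): error `Υ_K/log x`, `Υ_K ≍ |Δ_K|^{1/(n+1)}…`.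
* G. H. Hardy, E. M. Wright, *An Introduction to the Theory of Numbers*, §22.7. [HardyWright2008]
* J. Thorner, A. Zaman, ANT 13 (2019), Thm 1.4 (the Linnik-range prime ideal theorem behind the input).
-/

noncomputable section

open Finset Real MeasureTheory Filter Set Topology
open scoped NumberField

namespace Summit.QuantumAdvantage.QuantumAdvantage.Theorems.DegreeOnePrimesEscape

open Literature.NumberTheory.LFunctions Literature.NumberTheory.LFunctions.NumberField
  Literature.NumberTheory.LFunctions.ThetaMertens

/-! ### `θ_K` with a uniform `(log Q)²/(log t)²` error, for all `t ≥ 2` -/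

set_option maxHeartbeats 800000 in
/-- **`|θ_K(t) − t| ≤ Γ(n)·(log Q)²·t/(log t)²` for all `t ≥ 2`**, for every number field `K` of degree `n > 1`
without quadratic subfield (`Q = condQn K`): for `t ≥ Q^{a₁}` the decaying error of
`abs_chebyshevThetaIdeal_sub_self_le_of_noQuadraticSubfield` is bounded termwise by `e^{−s} ≤ 2/s²`,
`e^{−s} ≤ 24/s⁴` (tree `MoebiusSum.exp_neg_le_div_pow_four`); below `Q^{a₁}`, Chebyshev's bound `θ_K(t) ≤ n(log 4 + 4)t` and `log t < a₁ log Q` suffice. -/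
theorem abs_chebyshevThetaIdeal_sub_self_le_logSq_uniform (n : ℕ) (hn : 1 < n) :
    ∃ Γ : ℝ, 0 < Γ ∧ ∀ (K : Type) [Field K] [NumberField K], Module.finrank ℚ K = n →
      (∀ F : IntermediateField ℚ K, Module.finrank ℚ F ≠ 2) →
      ∀ t : ℝ, 2 ≤ t →
        |chebyshevThetaIdeal K t - t| ≤
          Γ * Real.log (ThornerZaman.condQn K) ^ 2 * t / Real.log t ^ 2 := by
  obtain ⟨ν, a₁, A, c, hν, ha₁, hA, hc, hmain⟩ := abs_chebyshevThetaIdeal_sub_self_le_of_noQuadraticSubfield n hn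
  set B : ℝ := (n : ℝ) * (Real.log 4 + 4) + 1 with hB
  have hlog4 : 0 < Real.log 4 := Real.log_pos (by norm_num)
  have hB0 : 0 < B := by positivity
  set Γ : ℝ := A * (26 / c ^ 2 + 2 / ν ^ 2) + B * a₁ ^ 2 with hΓ
  have hΓ0 : 0 < Γ := by positivity
  refine ⟨Γ, hΓ0, fun K _ _ hKn hnq t ht ↦ ?_⟩
  have hK : 1 < Module.finrank ℚ K := by rw [hKn]; exact hn
  set Q : ℝ := ThornerZaman.condQn K with hQ
  have hQ12 : (12 : ℝ) ≤ Q := ThornerZaman.twelve_le_condQn (K := K) hK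
  have hQ1 : (1 : ℝ) < Q := by linarith
  have hQ0 : (0 : ℝ) < Q := by linarith
  have hlog12 : (2 : ℝ) ≤ Real.log 12 := by
    rw [Real.le_log_iff_exp_le (by norm_num)]
    have := Real.exp_one_lt_d9
    have h : Real.exp 2 = Real.exp 1 * Real.exp 1 := by rw [← Real.exp_add]; norm_num
    rw [h]; nlinarith [Real.exp_pos (1:ℝ)]
  have hlogQ : 2 ≤ Real.log Q := hlog12.trans (Real.log_le_log (by norm_num) hQ12)
  have hlogQ1 : 1 ≤ Real.log Q ^ 2 := by nlinarith
  have ht0 : 0 < t := by linarith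
  have hlt : 0 < Real.log t := Real.log_pos (by linarith)
  have hlt2 : 0 < Real.log t ^ 2 := by positivity
  by_cases hcase : Q ^ a₁ ≤ t
  · -- the Linnik range: decaying error, bounded by `(log Q)²/(log t)²` termwise
    have h := hmain K hKn hnq t hcase
    set L := Real.log t with hL
    -- `e^{−s} ≤ 2/s²` for `s > 0` (`s²/2 ≤ e^s`; cf. `Literature.NumberTheory.Automorphic.exp_neg_le_two_div_sq`)
    have exp_neg_le_two_div_sq : ∀ {s : ℝ}, 0 < s → Real.exp (-s) ≤ 2 / s ^ 2 := by
      intro s hs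
      have h := Real.pow_div_factorial_le_exp s hs.le 2
      rw [Nat.factorial_two, Nat.cast_ofNat] at h
      rw [Real.exp_neg, inv_le_comm₀ (Real.exp_pos s) (by positivity)]
      calc (2 / s ^ 2)⁻¹ = s ^ 2 / 2 := by rw [inv_div]
        _ ≤ Real.exp s := h
    -- (a) `e^{−cL/log Q} ≤ 2 (log Q)²/(c² L²)`
    have ha' : Real.exp (-(c * L / Real.log Q)) ≤ 2 * Real.log Q ^ 2 / (c ^ 2 * L ^ 2) := by
      have hs : 0 < c * L / Real.log Q := by positivity
      refine (exp_neg_le_two_div_sq hs).trans (le_of_eq ?_)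
      field_simp
    -- (b) `e^{−√(cL)} ≤ 24/(c² L²)`
    have hb' : Real.exp (-Real.sqrt (c * L)) ≤ 24 / (c ^ 2 * L ^ 2) := by
      have hs : 0 < Real.sqrt (c * L) := Real.sqrt_pos.2 (by positivity)
      refine (Literature.NumberTheory.LFunctions.MoebiusSum.exp_neg_le_div_pow_four hs).trans (le_of_eq ?_)
      have h4 : Real.sqrt (c * L) ^ 4 = (c * L) ^ 2 := by
        rw [show (4:ℕ) = 2 * 2 by rfl, pow_mul, Real.sq_sqrt (by positivity)]
      rw [h4]; ring
    -- (c) `t^{−ν} = e^{−νL} ≤ 2/(ν² L²)`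
    have hc' : t ^ (-ν) ≤ 2 / (ν ^ 2 * L ^ 2) := by
      have hs : 0 < ν * L := by positivity
      have : t ^ (-ν) = Real.exp (-(ν * L)) := by
        rw [Real.rpow_def_of_pos ht0, ← hL]; ring_nf
      rw [this]
      refine (exp_neg_le_two_div_sq hs).trans (le_of_eq ?_)
      ring
    have hsum : Real.exp (-(c * L / Real.log Q)) + Real.exp (-Real.sqrt (c * L)) + t ^ (-ν) ≤
        (26 / c ^ 2 + 2 / ν ^ 2) * Real.log Q ^ 2 / L ^ 2 := by
      have h24 : 24 / (c ^ 2 * L ^ 2) ≤ 24 * Real.log Q ^ 2 / (c ^ 2 * L ^ 2) := by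
        apply div_le_div_of_nonneg_right _ (by positivity); nlinarith
      have h2 : 2 / (ν ^ 2 * L ^ 2) ≤ 2 * Real.log Q ^ 2 / (ν ^ 2 * L ^ 2) := by
        apply div_le_div_of_nonneg_right _ (by positivity); nlinarith
      calc Real.exp (-(c * L / Real.log Q)) + Real.exp (-Real.sqrt (c * L)) + t ^ (-ν)
          ≤ 2 * Real.log Q ^ 2 / (c ^ 2 * L ^ 2) + 24 * Real.log Q ^ 2 / (c ^ 2 * L ^ 2) +
              2 * Real.log Q ^ 2 / (ν ^ 2 * L ^ 2) := by linarith
        _ = (26 / c ^ 2 + 2 / ν ^ 2) * Real.log Q ^ 2 / L ^ 2 := by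
          field_simp; ring
    calc |chebyshevThetaIdeal K t - t|
        ≤ A * t * (Real.exp (-(c * L / Real.log Q)) + Real.exp (-Real.sqrt (c * L)) + t ^ (-ν)) := h
      _ ≤ A * t * ((26 / c ^ 2 + 2 / ν ^ 2) * Real.log Q ^ 2 / L ^ 2) := by gcongr
      _ = A * (26 / c ^ 2 + 2 / ν ^ 2) * Real.log Q ^ 2 * t / L ^ 2 := by ring
      _ ≤ Γ * Real.log Q ^ 2 * t / L ^ 2 := by
          apply div_le_div_of_nonneg_right _ hlt2.le
          have hBp : 0 ≤ B * a₁ ^ 2 := by positivity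
          have : A * (26 / c ^ 2 + 2 / ν ^ 2) ≤ Γ := by rw [hΓ]; linarith
          have hQt : 0 ≤ Real.log Q ^ 2 * t := by positivity
          nlinarith
  · -- below the Linnik range: Chebyshev
    rw [not_le] at hcase
    have hθ := chebyshevThetaIdeal_le_mul K ht0.le
    rw [hKn] at hθ
    have hθ0 := chebyshevThetaIdeal_nonneg K t
    have habs : |chebyshevThetaIdeal K t - t| ≤ B * t := by
      rw [abs_le, hB]; constructor <;> nlinarith
    have hlogt : Real.log t < a₁ * Real.log Q := by
      have := Real.log_lt_log ht0 hcase
      rwa [Real.log_rpow hQ0] at this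
    have hlt_sq : Real.log t ^ 2 ≤ a₁ ^ 2 * Real.log Q ^ 2 := by
      have h0 : 0 ≤ Real.log t := hlt.le
      nlinarith
    calc |chebyshevThetaIdeal K t - t| ≤ B * t := habs
      _ = B * t * Real.log t ^ 2 / Real.log t ^ 2 := by field_simp
      _ ≤ B * t * (a₁ ^ 2 * Real.log Q ^ 2) / Real.log t ^ 2 := by gcongr
      _ = B * a₁ ^ 2 * Real.log Q ^ 2 * t / Real.log t ^ 2 := by ring
      _ ≤ Γ * Real.log Q ^ 2 * t / Real.log t ^ 2 := by
          apply div_le_div_of_nonneg_right _ hlt2.le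
          have hAp : 0 ≤ A * (26 / c ^ 2 + 2 / ν ^ 2) := by positivity
          have : B * a₁ ^ 2 ≤ Γ := by rw [hΓ]; linarith
          have hQt : 0 ≤ Real.log Q ^ 2 * t := by positivity
          nlinarith

/-! ### Mertens' second theorem, uniformly -/

/-- **Mertens' second theorem for number fields, uniformly in the Linnik range** (see the module docstring):
for `n > 1` there is `Γ = Γ(n) > 0` such that for every number field `K` of degree `n` WITHOUT QUADRATIC
SUBFIELD there is a constant `M = M_K` with, for all `x ≥ 2`,
`|∑_{N𝔭 ≤ x} 1/N𝔭 − (log log x + M_K)| ≤ Γ·(log Q)²/(log x)²` (`Q = |d_K|·nⁿ`). -/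
theorem mertens_second_uniform (n : ℕ) (hn : 1 < n) :
    ∃ Γ : ℝ, 0 < Γ ∧ ∀ (K : Type) [Field K] [NumberField K], Module.finrank ℚ K = n →
      (∀ F : IntermediateField ℚ K, Module.finrank ℚ F ≠ 2) →
      ∃ M : ℝ, ∀ x : ℝ, 2 ≤ x →
        |∑ P ∈ (finite_primeIdealsLE K x).toFinset, (Ideal.absNorm P : ℝ)⁻¹ - (Real.log (Real.log x) + M)| ≤
          Γ * Real.log (ThornerZaman.condQn K) ^ 2 / Real.log x ^ 2 := by
  obtain ⟨Γ, hΓ, hθ⟩ := abs_chebyshevThetaIdeal_sub_self_le_logSq_uniform n hn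
  refine ⟨4 * Γ, by positivity, fun K _ _ hKn hnq ↦ ?_⟩
  set c : ℕ → ℝ := fun m ↦ (normPrimeIdealCount K m : ℝ) * Real.log m with hc
  have hc0 : c 0 = 0 := by simp [hc]
  have hc1 : c 1 = 0 := by simp [hc]
  set C : ℝ := Γ * Real.log (ThornerZaman.condQn K) ^ 2 with hC
  have hS : ∀ t : ℝ, 2 ≤ t → |∑ m ∈ Icc 0 ⌊t⌋₊, c m - t| ≤ C * t / Real.log t ^ 2 := by
    intro t ht
    have h := hθ K hKn hnq t ht
    rw [hC]
    exact h
  obtain ⟨M, hM⟩ := abs_sum_div_mul_log_sub_loglog_le_explicit hc0 hc1 hS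
  refine ⟨M, fun x hx ↦ ?_⟩
  rw [NumberField.sum_inv_absNorm_eq_sum K (by linarith)]
  have h := hM x hx
  simp only [hc] at h
  calc _ ≤ 4 * C / Real.log x ^ 2 := h
    _ = 4 * Γ * Real.log (ThornerZaman.condQn K) ^ 2 / Real.log x ^ 2 := by rw [hC]; ring

/-- **Uniqueness of Mertens' constant**: if `∑_{N𝔭 ≤ x} 1/N𝔭 − log log x − M → 0` along `x → ∞` for two
constants `M, M'`, then `M = M'`. -/
theorem mertensConstant_unique (K : Type) [Field K] [NumberField K] {M M' : ℝ}
    (hM : Tendsto (fun x : ℝ ↦ ∑ P ∈ (finite_primeIdealsLE K x).toFinset, (Ideal.absNorm P : ℝ)⁻¹ -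
      (Real.log (Real.log x) + M)) atTop (𝓝 0))
    (hM' : Tendsto (fun x : ℝ ↦ ∑ P ∈ (finite_primeIdealsLE K x).toFinset, (Ideal.absNorm P : ℝ)⁻¹ -
      (Real.log (Real.log x) + M')) atTop (𝓝 0)) :
    M = M' := by
  have h := hM'.sub hM
  simp only [sub_sub_sub_cancel_left, sub_zero] at h
  have hconst : Tendsto (fun _ : ℝ ↦ M - M') atTop (𝓝 (0 : ℝ)) := by
    refine h.congr fun x ↦ ?_
    ring
  have := tendsto_nhds_unique hconst tendsto_const_nhds
  linarith

/-- **The uniform bound holds for THE Mertens constant of `K`** (any witness `M` of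
`NumberField.exists_mertensConstant`, by uniqueness of the constant): for `K` of degree `n` without quadratic
subfield and `M, C` with `|∑_{N𝔭 ≤ x} 1/N𝔭 − (log log x + M)| ≤ C/log² x` (`x ≥ 2`), also
`|∑_{N𝔭 ≤ x} 1/N𝔭 − (log log x + M)| ≤ Γ(n)·(log Q)²/(log x)²` for all `x ≥ 2`. -/
theorem mertens_second_uniform_of_mertensConstant (n : ℕ) (hn : 1 < n) :
    ∃ Γ : ℝ, 0 < Γ ∧ ∀ (K : Type) [Field K] [NumberField K], Module.finrank ℚ K = n →
      (∀ F : IntermediateField ℚ K, Module.finrank ℚ F ≠ 2) →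
      ∀ M C : ℝ, (∀ x : ℝ, 2 ≤ x →
        |∑ P ∈ (finite_primeIdealsLE K x).toFinset, (Ideal.absNorm P : ℝ)⁻¹ - (Real.log (Real.log x) + M)| ≤
          C / Real.log x ^ 2) →
      ∀ x : ℝ, 2 ≤ x →
        |∑ P ∈ (finite_primeIdealsLE K x).toFinset, (Ideal.absNorm P : ℝ)⁻¹ - (Real.log (Real.log x) + M)| ≤
          Γ * Real.log (ThornerZaman.condQn K) ^ 2 / Real.log x ^ 2 := by
  obtain ⟨Γ, hΓ, h⟩ := mertens_second_uniform n hn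
  refine ⟨Γ, hΓ, fun K _ _ hKn hnq M C hMC x hx ↦ ?_⟩
  obtain ⟨M', hM'⟩ := h K hKn hnq
  have h1 := NumberField.tendsto_sum_inv_absNorm_sub_loglog K hMC
  have h2 := NumberField.tendsto_sum_inv_absNorm_sub_loglog K (C := Γ * Real.log (ThornerZaman.condQn K) ^ 2) hM'
  have hMM : M = M' := mertensConstant_unique K h1 h2
  rw [hMM]
  exact hM' x hx

/-- **The `ε`-form**: with `C(ε) = Γ/ε + 1`, for every `K` of degree `n` without quadratic subfield, every
`ε > 0` and every `x ≥ Q^{C(ε)}`: `|∑_{N𝔭 ≤ x} 1/N𝔭 − log log x − M_K| ≤ ε` — Mertens' second theorem holds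
with error `ε` ALREADY at `x = Q^{C(n,ε)}`, a polynomial range in the discriminant. -/
theorem mertens_second_uniform_eps (n : ℕ) (hn : 1 < n) :
    ∃ Γ : ℝ, 0 < Γ ∧ ∀ (K : Type) [Field K] [NumberField K], Module.finrank ℚ K = n →
      (∀ F : IntermediateField ℚ K, Module.finrank ℚ F ≠ 2) →
      ∃ M : ℝ, ∀ ε : ℝ, 0 < ε → ∀ x : ℝ, ThornerZaman.condQn K ^ (Γ / ε + 1) ≤ x →
        |∑ P ∈ (finite_primeIdealsLE K x).toFinset, (Ideal.absNorm P : ℝ)⁻¹ - (Real.log (Real.log x) + M)| ≤ ε := by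
  obtain ⟨Γ, hΓ, h⟩ := mertens_second_uniform n hn
  refine ⟨Γ, hΓ, fun K _ _ hKn hnq ↦ ?_⟩
  obtain ⟨M, hM⟩ := h K hKn hnq
  refine ⟨M, fun ε hε x hx ↦ ?_⟩
  have hK : 1 < Module.finrank ℚ K := by rw [hKn]; exact hn
  set Q : ℝ := ThornerZaman.condQn K with hQ
  have hQ12 : (12 : ℝ) ≤ Q := ThornerZaman.twelve_le_condQn (K := K) hK
  have hQ1 : (1 : ℝ) < Q := by linarith
  have hQ0 : (0 : ℝ) < Q := by linarith
  have hlogQ0 : 0 < Real.log Q := Real.log_pos hQ1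
  have hΓε : (0 : ℝ) ≤ Γ / ε := by positivity
  have hC1 : (1 : ℝ) ≤ Γ / ε + 1 := by linarith
  have hxQ : Q ≤ x := by
    have : Q ^ (1 : ℝ) ≤ Q ^ (Γ / ε + 1) := Real.rpow_le_rpow_of_exponent_le hQ1.le hC1
    rw [Real.rpow_one] at this; linarith
  have hx2 : 2 ≤ x := by linarith
  have hlogx : (Γ / ε + 1) * Real.log Q ≤ Real.log x := by
    have := Real.log_le_log (by positivity) hx
    rwa [Real.log_rpow hQ0] at this
  have hlx0 : 0 < Real.log x := by nlinarith
  refine (hM x hx2).trans ?_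
  rw [div_le_iff₀ (by positivity)]
  -- `Γ (log Q)² ≤ ε (log x)²` since `log x ≥ (Γ/ε + 1) log Q` and `(Γ/ε+1)² ε ≥ Γ`
  have h1 : Γ * Real.log Q ^ 2 ≤ ε * ((Γ / ε + 1) * Real.log Q) ^ 2 := by
    have hε2 : Γ ≤ ε * (Γ / ε + 1) ^ 2 := by
      have hGe : ε * (Γ / ε) = Γ := by field_simp
      nlinarith [mul_pos hε (show (0:ℝ) < (Γ / ε) ^ 2 + Γ / ε + 1 by positivity)]
    nlinarith [sq_nonneg (Real.log Q)]
  have h2 : ((Γ / ε + 1) * Real.log Q) ^ 2 ≤ Real.log x ^ 2 := by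
    have h0 : 0 ≤ (Γ / ε + 1) * Real.log Q := by positivity
    nlinarith
  nlinarith [hε]

/-! ### Odd degree; cubic fields -/

/-- **Uniform Mertens II for every number field of ODD degree `n > 1`.** -/
theorem mertens_second_uniform_of_odd (n : ℕ) (hn : 1 < n) (hodd : Odd n) :
    ∃ Γ : ℝ, 0 < Γ ∧ ∀ (K : Type) [Field K] [NumberField K], Module.finrank ℚ K = n →
      ∃ M : ℝ, ∀ x : ℝ, 2 ≤ x →
        |∑ P ∈ (finite_primeIdealsLE K x).toFinset, (Ideal.absNorm P : ℝ)⁻¹ - (Real.log (Real.log x) + M)| ≤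
          Γ * Real.log (ThornerZaman.condQn K) ^ 2 / Real.log x ^ 2 := by
  obtain ⟨Γ, hΓ, h⟩ := mertens_second_uniform n hn
  refine ⟨Γ, hΓ, fun K _ _ hKn ↦ h K hKn ?_⟩
  have hoddK : Odd (Module.finrank ℚ K) := by rw [hKn]; exact hodd
  exact forall_finrank_ne_two_of_odd hoddK

/-- **Uniform Mertens II for every CUBIC field** (`Q = 27·|d_K|`): there is an absolute `Γ > 0` such that every
cubic number field `K` has a constant `M_K` with `|∑_{N𝔭 ≤ x} 1/N𝔭 − log log x − M_K| ≤ Γ (log Q)²/(log x)²`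
for all `x ≥ 2` — GRH-free, Siegel-free. -/
theorem mertens_second_uniform_cubic :
    ∃ Γ : ℝ, 0 < Γ ∧ ∀ (K : Type) [Field K] [NumberField K], Module.finrank ℚ K = 3 →
      ∃ M : ℝ, ∀ x : ℝ, 2 ≤ x →
        |∑ P ∈ (finite_primeIdealsLE K x).toFinset, (Ideal.absNorm P : ℝ)⁻¹ - (Real.log (Real.log x) + M)| ≤
          Γ * Real.log (ThornerZaman.condQn K) ^ 2 / Real.log x ^ 2 :=
  mertens_second_uniform_of_odd 3 (by norm_num) (by decide)

end Summit.QuantumAdvantage.QuantumAdvantage.Theorems.DegreeOnePrimesEscape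

end
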